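import Mathlib
import HarnessLib
import Summits.NavierStokesRegularity.NavierStokesRegularity.Theorems.CompletionRelayChainPhaseISoundStep2

/-!
# Route `CompletionRelayChain` — crux `RelayFrontStep` (stmt-NavierStokesRegularity-24850), K-side of `stub_phaseI`,
  work package K5-h: `run` as an iteration with all tests passed; the invariant along the whole run; grid coverage

MODEL-lattice bookkeeping (rung TL-M3-R64); nothing here is a statement about the Navier–Stokes equations.
-/

noncomputable section

set_option linter.dupNamespace false

namespace Summit.NavierStokesRegularity.NavierStokesRegularity.Cruxes.RelayFrontStep.PhaseI

open Set Checker
open Literature.Analysis.FluidPDE.TaoCascade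

variable {α : Fin 4 → Fin 4 → Fin 4 → ℤ × ℤ × ℤ → ℝ} {τ : ℝ} {S₀ F₀ B₀ : Fin 4 → ℤ → ℝ} {S F : Fin 4 → ℤ → ℝ → ℝ}

/-! ### `run` = iterate `step` while every test passes -/

attribute [local irreducible] Checker.step

/-- `n`-fold iteration of the step map (ignoring the tests). [this file] -/
def iter (st : State) : ℕ → State
  | 0 => st
  | n + 1 => (step (iter st n)).next

/-- `iter st 0 = st`. [this file] -/
theorem iter_zero (st : State) : iter st 0 = st := rfl

/-- `iter st (n+1) = (step (iter st n)).next`. [this file] -/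
theorem iter_succ (st : State) (n : ℕ) : iter st (n + 1) = (step (iter st n)).next := rfl

/-- Shifted iteration. [this file] -/
theorem iter_succ_left (st : State) : ∀ n, iter (step st).next n = iter st (n + 1)
  | 0 => by rw [iter_succ, iter_zero, iter_zero]
  | n + 1 => by rw [iter_succ, iter_succ, iter_succ_left st n]

/-- **`run n st = some st'` iff every test along the way passed; then `st' = iter st n`.** [this file] -/
theorem run_eq_some : ∀ (n : ℕ) (st st' : State), run n st = some st' →
    (∀ k < n, (step (iter st k)).ok = true) ∧ st' = iter st n
  | 0, st, st', h => by
    simp only [run, Option.some.injEq] at h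
    exact ⟨fun k hk => absurd hk (Nat.not_lt_zero k), h.symm⟩
  | n + 1, st, st', h => by
    rw [run] at h
    by_cases hok : (step st).ok = true
    · simp only [hok, if_true] at h
      obtain ⟨hall, heq⟩ := run_eq_some n _ _ h
      refine ⟨fun k hk => ?_, by rw [heq, iter_succ_left]⟩
      rcases k with _ | k
      · rw [iter_zero]; exact hok
      · have := hall k (by omega)
        rwa [iter_succ_left] at this
    · simp only [hok] at h; exact absurd h (by simp)

/-- `checkCell cell = true` unfolded: all `147` steps pass and the footer holds at `iter (startState cell) 147`.
[this file] -/
theorem checkCell_spec {cell : Cell} (h : checkCell cell = true) :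
    (∀ k < 147, (step (iter (startState cell) k)).ok = true) ∧ footer (iter (startState cell) 147) = true := by
  unfold checkCell at h
  cases hrun : run nSteps (startState cell) with
  | none => rw [hrun] at h; exact absurd h (by simp)
  | some st =>
    rw [hrun] at h
    obtain ⟨hall, heq⟩ := run_eq_some nSteps _ _ hrun
    rw [heq] at h
    exact ⟨hall, h⟩

/-! ### The invariant along the run -/

/-- **The node invariant holds at every node `n ≤ 147` of a passing run.** [this file] -/
theorem nodeInv_iter (H : Hyps α τ S₀ F₀ B₀ S F) (h2 : Shell2Bound F₀ S F) {θ : Fin 7 → ℝ} (hθ : TM.InBox θ)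
    {s0 : State} (h0 : NodeInv S F θ 0 s0) (hall : ∀ k < 147, (step (iter s0 k)).ok = true) :
    ∀ n, n ≤ 147 → NodeInv S F θ n (iter s0 n)
  | 0, _ => h0
  | n + 1, hn => by
    have ih := nodeInv_iter H h2 hθ h0 hall n (Nat.le_of_succ_le hn)
    have hmT : ((n : ℝ) + 1) * hR ≤ 147 / 64 := by
      have : ((n : ℝ) + 1) ≤ 147 := by exact_mod_cast hn
      simp only [hR]; nlinarith
    exact nodeInv_step H h2 hθ hmT ih (hall n (Nat.lt_of_succ_le hn))

/-! ### Grid coverage -/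

/-- A point of `[lo, hi]` lies in one of the `n ≥ 1` closed pieces. [this file] -/
theorem exists_piece {lo hi : ℚ} {n : ℕ} (hn : 0 < n) {v : ℝ} (hv1 : (lo : ℝ) ≤ v) (hv2 : v ≤ hi) :
    ∃ j < n, (((piece lo hi n j).1 : ℚ) : ℝ) ≤ v ∧ v ≤ (((piece lo hi n j).2 : ℚ) : ℝ) := by
  classical
  -- the set of indices whose piece's right end is ≥ v is nonempty (j = n-1)
  have hP : ∃ j, v ≤ (((piece lo hi n j).2 : ℚ) : ℝ) := by
    refine ⟨n - 1, ?_⟩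
    simp only [piece]; push_cast
    have hn' : ((n - 1 : ℕ) : ℝ) + 1 = n := by
      rw [Nat.cast_sub (by omega)]; push_cast; ring
    rw [hn', mul_div_assoc, div_self (by exact_mod_cast hn.ne'), mul_one]
    linarith
  let j := Nat.find hP
  have hj : v ≤ (((piece lo hi n j).2 : ℚ) : ℝ) := Nat.find_spec hP
  have hjmin : ∀ i < j, ¬ v ≤ (((piece lo hi n i).2 : ℚ) : ℝ) := fun i hi' => Nat.find_min hP hi'
  refine ⟨j, ?_, ?_, hj⟩
  · by_contra hjn
    push Not at hjn
    have := hjmin (n - 1) (by omega)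
    apply this
    simp only [piece]; push_cast
    have hn' : ((n - 1 : ℕ) : ℝ) + 1 = n := by
      rw [Nat.cast_sub (by omega)]; push_cast; ring
    rw [hn', mul_div_assoc, div_self (by exact_mod_cast hn.ne'), mul_one]
    linarith
  · rcases Nat.eq_zero_or_pos j with hj0 | hjpos
    · simp only [piece, hj0]; push_cast; simp; exact hv1
    · have hprev := hjmin (j - 1) (by omega)
      push Not at hprev
      simp only [piece] at hprev ⊢; push_cast at hprev ⊢
      have : ((j - 1 : ℕ) : ℝ) + 1 = j := by rw [Nat.cast_sub (by omega)]; push_cast; ring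
      rw [this] at hprev
      exact hprev.le

/-- Every point of the parameter box lies in some grid cell (with nondegenerate sides). [this file] -/
theorem exists_cell (y : Fin 7 → ℝ) (hy : ∀ j, (((prange j).1 : ℚ) : ℝ) ≤ y j ∧ y j ≤ (((prange j).2 : ℚ) : ℝ)) :
    ∃ cell ∈ cells, ∀ j, ((cell.plo j : ℚ) : ℝ) ≤ y j ∧ y j ≤ ((cell.phi j : ℚ) : ℝ) ∧ cell.plo j < cell.phi j := by
  have hpr : ∀ j : Fin 7, (prange j).1 < (prange j).2 := by
    intro j; fin_cases j <;> simp [prange, rtHalf] <;> norm_num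
  have hgn : ∀ j : Fin 7, 0 < gridN j := by intro j; fin_cases j <;> simp [gridN]
  have hex : ∀ j : Fin 7, ∃ i < gridN j, (((piece (prange j).1 (prange j).2 (gridN j) i).1 : ℚ) : ℝ) ≤ y j ∧
      y j ≤ (((piece (prange j).1 (prange j).2 (gridN j) i).2 : ℚ) : ℝ) :=
    fun j => exists_piece (hgn j) (hy j).1 (hy j).2
  choose idx hidx hmem using hex
  have hpiece_lt : ∀ j, (piece (prange j).1 (prange j).2 (gridN j) (idx j)).1 <
      (piece (prange j).1 (prange j).2 (gridN j) (idx j)).2 := by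
    intro j
    have h1 := hpr j; have h2 := hgn j
    simp only [piece]
    have hn : (0 : ℚ) < (gridN j : ℚ) := by exact_mod_cast h2
    have e : (prange j).1 + ((prange j).2 - (prange j).1) * ((idx j : ℚ) + 1) / (gridN j : ℚ) =
        (prange j).1 + ((prange j).2 - (prange j).1) * (idx j : ℚ) / (gridN j : ℚ) +
          ((prange j).2 - (prange j).1) / (gridN j : ℚ) := by field_simp; ring
    rw [e]
    have : (0 : ℚ) < ((prange j).2 - (prange j).1) / (gridN j) := div_pos (by linarith) hn
    linarith
  refine ⟨cellOf idx, ?_, fun j => ⟨(hmem j).1, (hmem j).2, hpiece_lt j⟩⟩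
  -- membership in the enumerated list
  have h0 := hidx 0; have h1 := hidx 1; have h2 := hidx 2; have h3 := hidx 3; have h4 := hidx 4
  have h5 := hidx 5; have h6 := hidx 6
  simp only [gridN, Matrix.cons_val] at h0 h1 h2 h3 h4 h5 h6
  have hidx_eq : idx = ![idx 0, idx 1, idx 2, idx 3, idx 4, idx 5, idx 6] := by
    funext j; fin_cases j <;> rfl
  simp only [cells, List.mem_flatMap, List.mem_map, List.mem_range]
  exact ⟨idx 0, h0, idx 1, h1, idx 2, h2, idx 3, h3, idx 4, h4, idx 5, h5, idx 6, h6, by rw [← hidx_eq]⟩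

end Summit.NavierStokesRegularity.NavierStokesRegularity.Cruxes.RelayFrontStep.PhaseI

end
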